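import Mathlib
import Summits.QuantumFields.BalabanUV.T4Continuum.Support.SliceFlatStencil
import Summits.QuantumFields.BalabanUV.T4Continuum.Support.SliceFlatHeatTorus
import Summits.QuantumFields.BalabanUV.T4Continuum.Support.SliceFlatFreeKernel

/-!
# T⁴ programme, node NE3 (η-rate of the minimisers) — THE FLAT RUNG, part 11: the FREE massive unit-lattice resolvent
# `F = (stencilE + n⁻²)⁻¹` on the NE3 carrier — character inversion, heat-kernel (Laplace) representation, and the
# block-localised bound `Σ_{q ∈ Δ(y₁)} |F(p+e_ν, q) − F(p, q)| ≤ C_d·n·e^{−α_d·nbd}` for its unit row differences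

Fifteenth generation of the NE3 prover lineage P1 of the cell `pub-balaban`, file 5 of the free-gradient chain
(`SliceFlatHeatOneDim → SliceFlatHeatWeighted → SliceFlatHeatTorus → SliceFlatFreeKernel → SliceFlatFreeResolvent →
SliceFlatGradient`; end point: the flat `hT31` item 1 of the lineage's one type p199789).  The flat level operator of the lineage is `kFlat j = stencilE + massKernel_j
+ flatNg j` (`SliceFlatStencil.flatE_eq_stencil`, definition of `SliceFlatOperators.flatNg`), `stencilE` the unit vector-Laplacian
stencil on the carrier `(ℤ/NL^k)^{d+1} × Fin (d+1)` and `n = L^{min(j,k)}` the block side.  THIS FILE constructs and controls the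
FREE comparison operator of part 12's resolvent identity from part 10's scalar kernel `freeKer` (lattice equation
`freeKer_laplace`, heat representation `freeKer_eq_integral`):
 * §3 on the NE3 carrier: `freeOp j (p,q) = 𝟙[p₂ = q₂]·freeKer n⁻² (p₁ − q₁)` with **`stencil_mul_freeOp`**:
   `(stencilE + n⁻²·1)·freeOp j = 1` (and `freeOp_mul_stencil`);
 * §4 the unit ROW DIFFERENCE `rowDiff ν A (p,q) = A((p₁+e_ν,p₂),q) − A(p,q)` and **`cubeSum_rowDiff_freeOp_le`**:
   `Σ_{q : cubeI j q = y₁} |rowDiff ν (freeOp j) p q| ≤ freeC d · n · e^{−freeα d · nbd_j(cubeI j p, y₁)}` with `freeC d = 5040·48^d`,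
   `freeα d = 1/(32(d+1))` — from part 9's `blockSum_rowDiff_prodHeat_le` at heat time `2t` integrated against `e^{−t/n²}`
   (the weight's cost `e^{t/(64n²)}` is absorbed, `∫₀^∞ t^{−1/2}e^{−t/(2n²)}dt = √(2π)·n`).
So the free gradient has block row sums `O(n)` — one power of `n` below the `O(n²)` of the kernel itself ([B9] (3.42): prefactor
`L^jη` for `∇G` against `(L^jη)²` for `G`) — with exponential decay in the block distance and constants depending on `d` only.

Honest framing: finite-T⁴ ultraviolet bookkeeping about MINIMISERS (rung (B)+1 of the cell's ladder); no conditional of the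
cell (`BetaPertH`, (B), (B^μ)) is used or hidden; nothing bears on infinite volume, a mass gap, or the Clay problem; NE3 is NOT
proved by this file.  ABSOLUTE RULE of the cell kept: inputs are Mathlib and kernel-proved tree modules only (the lineage's
`SliceFlatStencil`, parts 9–10); every declaration is
a [model] definition or a [folklore] theorem; no `def … : Prop`, no `sorry`, no axioms beyond Mathlib's.  PLACEMENT (human rule
2026-08-19): cell work under `Summits/QuantumFields/BalabanUV/`; moves nothing.  Records: `t4/T4-EST-U1b-OSC.md` v1.32,
`t4/T4-EST-NE3-P1.md` v2.31 of the cell `pub-balaban`.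
-/

noncomputable section

open Real Finset Filter MeasureTheory Set

namespace Summit.QuantumFields.BalabanUV.T4Continuum.SliceFlatFreeResolvent

open Literature.Probability.LatticeModels
open Literature.MathematicalPhysics.QuantumFieldTheory.Balaban1983to89.TreeLengthTorus (TPt)
open Summit.QuantumFields.BalabanUV.T4Continuum.SliceTorusBlocks
open Summit.QuantumFields.BalabanUV.T4Continuum.SliceTorusTower
open Summit.QuantumFields.BalabanUV.T4Continuum.SliceCovariantTower
open Summit.QuantumFields.BalabanUV.T4Continuum.SliceFlatPropagator
open Summit.QuantumFields.BalabanUV.T4Continuum.SliceFlatStencil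
open Summit.QuantumFields.BalabanUV.T4Continuum.SliceFlatHeatOneDim
open Summit.QuantumFields.BalabanUV.T4Continuum.SliceFlatHeatTorus
open Summit.QuantumFields.BalabanUV.T4Continuum.SliceFlatFreeKernel

/-! ## §3  The free resolvent on the NE3 carrier and its inverse identity -/
section Carrier

variable (d k N L : ℕ) [NeZero N] [NeZero L]

/-- **The free massive unit-lattice resolvent on the NE3 carrier** at level `j`: diagonal in the component index, kernel
`freeKer n⁻² (p₁ − q₁)` in the site, `n = L^{min(j,k)}` — the inverse of `stencilE + n⁻²·1` (`stencil_mul_freeOp`). [model] -/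
def freeOp (j : ℕ) : Matrix (TPt (d + 1) (N * L ^ k) × Fin (d + 1)) (TPt (d + 1) (N * L ^ k) × Fin (d + 1)) ℝ :=
  fun p q => if p.2 = q.2 then freeKer (((side k L j : ℝ) ^ 2)⁻¹) (p.1 - q.1) else 0

/-- The mass `n⁻²` is positive. [folklore] -/
theorem mass_pos (j : ℕ) : (0 : ℝ) < (((side k L j : ℝ) ^ 2)⁻¹) := by
  have := one_le_side k L j; positivity

/-- Contracting a Kronecker row: `Σ_r δ_{a r}·G r = G a`. [folklore] -/
theorem sum_kd_mul (a : TPt (d + 1) (N * L ^ k) × Fin (d + 1)) (G : TPt (d + 1) (N * L ^ k) × Fin (d + 1) → ℝ) :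
    ∑ r, kd d k N L a r * G r = G a := by
  simp only [kd, ite_mul, one_mul, zero_mul, Finset.sum_ite_eq, Finset.mem_univ, if_true]

/-- The stencil applied to a matrix: `(stencilE·F)(p,q) = Σ_ν [(F(p,q) − F(p⁺ν,q)) + (F(p,q) − F(p⁻ν,q))]`. [folklore] -/
theorem stencilE_mul_apply (F : Matrix (TPt (d + 1) (N * L ^ k) × Fin (d + 1)) (TPt (d + 1) (N * L ^ k) × Fin (d + 1)) ℝ)
    (p q : TPt (d + 1) (N * L ^ k) × Fin (d + 1)) :
    (stencilE d k N L * F) p q = ∑ ν : Fin (d + 1), ((F p q - F (p.1 + Pi.single ν 1, p.2) q)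
      + (F p q - F (p.1 - Pi.single ν 1, p.2) q)) := by
  rw [Matrix.mul_apply]
  simp only [stencilE, Finset.sum_mul, add_mul, sub_mul]
  rw [Finset.sum_comm]
  refine Finset.sum_congr rfl fun ν _ => ?_
  rw [Finset.sum_add_distrib, Finset.sum_sub_distrib, Finset.sum_sub_distrib, sum_kd_mul, sum_kd_mul, sum_kd_mul]

/-- **`(stencilE + n⁻²·1)·freeOp j = 1`**: the free operator inverts the massive unit vector-Laplacian stencil. [folklore] -/
theorem stencil_mul_freeOp (j : ℕ) :
    (stencilE d k N L + (((side k L j : ℝ) ^ 2)⁻¹) • (1 : Matrix _ _ ℝ)) * freeOp d k N L j = 1 := by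
  ext p q
  rw [Matrix.add_mul, Matrix.smul_mul, Matrix.one_mul, Matrix.add_apply, Matrix.smul_apply, stencilE_mul_apply,
    smul_eq_mul, Matrix.one_apply]
  by_cases hc : p.2 = q.2
  · have hF : ∀ x : TPt (d + 1) (N * L ^ k), freeOp d k N L j (x, p.2) q = freeKer (((side k L j : ℝ) ^ 2)⁻¹) (x - q.1) := by
      intro x; simp [freeOp, hc]
    have hp : p = (p.1, p.2) := rfl
    rw [hp]
    simp only [hF]
    have e1 : ∀ ν : Fin (d + 1), p.1 + Pi.single ν 1 - q.1 = (p.1 - q.1) + Pi.single ν 1 := fun ν => by abel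
    have e2 : ∀ ν : Fin (d + 1), p.1 - Pi.single ν 1 - q.1 = (p.1 - q.1) - Pi.single ν 1 := fun ν => by abel
    simp only [e1, e2]
    have h := freeKer_laplace (mass_pos k L j) (p.1 - q.1)
    have hre : ∑ ν : Fin (d + 1), ((freeKer (((side k L j : ℝ) ^ 2)⁻¹) (p.1 - q.1)
          - freeKer (((side k L j : ℝ) ^ 2)⁻¹) (p.1 - q.1 + Pi.single ν 1))
        + (freeKer (((side k L j : ℝ) ^ 2)⁻¹) (p.1 - q.1) - freeKer (((side k L j : ℝ) ^ 2)⁻¹) (p.1 - q.1 - Pi.single ν 1)))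
        = ∑ ν : Fin (d + 1), (2 * freeKer (((side k L j : ℝ) ^ 2)⁻¹) (p.1 - q.1)
          - freeKer (((side k L j : ℝ) ^ 2)⁻¹) (p.1 - q.1 + Pi.single ν 1)
          - freeKer (((side k L j : ℝ) ^ 2)⁻¹) (p.1 - q.1 - Pi.single ν 1)) :=
      Finset.sum_congr rfl fun ν _ => by ring
    rw [hre, h]
    by_cases hpq : p.1 = q.1
    · rw [if_pos (sub_eq_zero.2 hpq), if_pos (Prod.ext hpq hc)]
    · rw [if_neg (fun h0 => hpq (sub_eq_zero.1 h0)), if_neg (fun h0 => hpq (congrArg Prod.fst h0))]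
  · have hF : ∀ x : TPt (d + 1) (N * L ^ k), freeOp d k N L j (x, p.2) q = 0 := by intro x; simp [freeOp, hc]
    have hp : p = (p.1, p.2) := rfl
    rw [hp]
    simp only [hF, sub_zero, add_zero, Finset.sum_const_zero, mul_zero]
    rw [if_neg (fun h0 => hc (congrArg Prod.snd h0))]

/-- `freeOp j·(stencilE + n⁻²·1) = 1` (square matrices). [folklore] -/
theorem freeOp_mul_stencil (j : ℕ) :
    freeOp d k N L j * (stencilE d k N L + (((side k L j : ℝ) ^ 2)⁻¹) • (1 : Matrix _ _ ℝ)) = 1 :=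
  mul_eq_one_comm.1 (stencil_mul_freeOp d k N L j)

end Carrier

/-! ## §4  The unit row difference of the free resolvent: block-localised bound -/
section Gradient

variable (d k N L : ℕ) [NeZero N] [NeZero L]

/-- **The unit ROW DIFFERENCE** of a matrix on the carrier in direction `ν`: `(rowDiff ν A)(p,q) = A((p₁+e_ν,p₂),q) − A(p,q)`
(a forward unit difference of every column, as a function of the row site). [model] [folklore] -/
def rowDiff (ν : Fin (d + 1)) (A : Matrix (TPt (d + 1) (N * L ^ k) × Fin (d + 1)) (TPt (d + 1) (N * L ^ k) × Fin (d + 1)) ℝ) :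
    Matrix (TPt (d + 1) (N * L ^ k) × Fin (d + 1)) (TPt (d + 1) (N * L ^ k) × Fin (d + 1)) ℝ :=
  fun p q => A (p.1 + Pi.single ν 1, p.2) q - A p q

/-- Row differences commute with right multiplication. [folklore] -/
theorem rowDiff_mul (ν : Fin (d + 1)) (A B : Matrix (TPt (d + 1) (N * L ^ k) × Fin (d + 1))
    (TPt (d + 1) (N * L ^ k) × Fin (d + 1)) ℝ) : rowDiff d k N L ν (A * B) = rowDiff d k N L ν A * B := by
  ext p q
  simp only [rowDiff, Matrix.mul_apply, ← Finset.sum_sub_distrib, sub_mul]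

omit [NeZero N] [NeZero L] in
/-- Row differences are additive. [folklore] -/
theorem rowDiff_add (ν : Fin (d + 1)) (A B : Matrix (TPt (d + 1) (N * L ^ k) × Fin (d + 1))
    (TPt (d + 1) (N * L ^ k) × Fin (d + 1)) ℝ) : rowDiff d k N L ν (A + B) = rowDiff d k N L ν A + rowDiff d k N L ν B := by
  ext p q; simp only [rowDiff, Matrix.add_apply]; ring

/-- The constant of the free gradient bound, a function of `d` only. [folklore] -/
def freeC (d : ℕ) : ℝ := 5040 * 48 ^ d

/-- The decay rate of the free gradient bound, a function of `d` only. [folklore] -/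
def freeα (d : ℕ) : ℝ := 1 / (32 * ((d : ℝ) + 1))

/-- `0 < freeα d ≤ 1/32`. [folklore] -/
theorem freeα_pos_le (d : ℕ) : 0 < freeα d ∧ freeα d ≤ 1 / 32 := by
  unfold freeα
  refine ⟨by positivity, ?_⟩
  exact one_div_le_one_div_of_le (by norm_num) (by nlinarith [(Nat.cast_nonneg d : (0 : ℝ) ≤ d)])

/-- `|q^P_t(c)| ≤ 48` for `t > 0` (a single term of part 9's weighted bound at `β = 0`). [folklore] -/
theorem abs_torusHeatKernel_le {P : ℕ} [NeZero P] {t : ℝ} (ht : 0 < t) (c : ZMod P) : |torusHeatKernel t c| ≤ 48 := by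
  have h := weighted_sum_torusHeatKernel_le (P := P) ht le_rfl (show (0 : ℝ) ≤ 1 / 16 by norm_num)
  simp only [zero_mul, Real.exp_zero, one_mul, mul_zero, zero_pow two_ne_zero, mul_one] at h
  exact (Finset.single_le_sum (fun c _ => abs_nonneg (torusHeatKernel t c)) (Finset.mem_univ c)).trans
    (by simpa using h)

/-- The entries of the free operator as Laplace integrals of the product heat kernel. [folklore] -/
theorem freeOp_apply (j : ℕ) (p q : TPt (d + 1) (N * L ^ k) × Fin (d + 1)) :
    freeOp d k N L j p q = if p.2 = q.2 then ∫ t in Ioi (0 : ℝ),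
      Real.exp (-((((side k L j : ℝ) ^ 2)⁻¹) * t)) * prodHeat (2 * t) p.1 q.1 else 0 := by
  unfold freeOp
  split_ifs with h
  · rw [freeKer_eq_integral (mass_pos k L j)]; rfl
  · rfl

/-- Integrability of the Laplace integrands (bounded continuous heat factor against `e^{−m²t}`). [folklore] -/
theorem integrable_exp_mul_prodHeat (j : ℕ) (x z : TPt (d + 1) (N * L ^ k)) :
    IntegrableOn (fun t : ℝ => Real.exp (-((((side k L j : ℝ) ^ 2)⁻¹) * t)) * prodHeat (2 * t) x z) (Ioi 0) := by
  have hm := mass_pos k L j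
  have hmaj : IntegrableOn (fun t : ℝ => (48 : ℝ) ^ (d + 1) * Real.exp (-(((side k L j : ℝ) ^ 2)⁻¹) * t)) (Ioi 0) :=
    (exp_neg_integrableOn_Ioi 0 hm).const_mul _
  refine Integrable.mono' hmaj ?_ ?_
  · refine (Continuous.mul (by fun_prop) ?_).aestronglyMeasurable
    unfold prodHeat
    exact continuous_finsetProd _ fun i _ => (continuous_torusHeatKernel (x i - z i)).comp (by fun_prop)
  · refine (ae_restrict_iff' measurableSet_Ioi).2 (Filter.Eventually.of_forall fun t (ht : 0 < t) => ?_)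
    rw [norm_mul, Real.norm_eq_abs, Real.norm_eq_abs, abs_of_pos (Real.exp_pos _), mul_comm, neg_mul]
    refine mul_le_mul_of_nonneg_right ?_ (Real.exp_pos _).le
    unfold prodHeat
    rw [Finset.abs_prod]
    calc ∏ i, |torusHeatKernel (2 * t) (x i - z i)| ≤ ∏ _i : Fin (d + 1), (48 : ℝ) :=
          Finset.prod_le_prod (fun i _ => abs_nonneg _) fun i _ => abs_torusHeatKernel_le (by linarith) _
      _ = 48 ^ (d + 1) := by simp

/-- The block-fibre sum of the row difference of the free operator reduces to the site fibre (only the component `q₂ = p₂`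
contributes) and to Laplace integrals of the row difference of the product heat kernel. [folklore] -/
theorem cubeSum_rowDiff_freeOp_eq (j : ℕ) (ν : Fin (d + 1)) (p : TPt (d + 1) (N * L ^ k) × Fin (d + 1))
    (y₁ : TPt (d + 1) (levM k N L j)) :
    ∑ q ∈ Finset.univ.filter (fun q => cubeI (d + 1) k N L (Fin (d + 1)) j q = y₁), |rowDiff d k N L ν (freeOp d k N L j) p q|
      = ∑ z ∈ Finset.univ.filter (fun z : TPt (d + 1) (N * L ^ k) => cube (d + 1) k N L j z = y₁),
          |∫ t in Ioi (0 : ℝ), Real.exp (-((((side k L j : ℝ) ^ 2)⁻¹) * t)) *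
            (prodHeat (2 * t) (p.1 + Pi.single ν 1) z - prodHeat (2 * t) p.1 z)| := by
  classical
  have hsub : ∀ z : TPt (d + 1) (N * L ^ k),
      (∫ t in Ioi (0 : ℝ), Real.exp (-((((side k L j : ℝ) ^ 2)⁻¹) * t)) * prodHeat (2 * t) (p.1 + Pi.single ν 1) z)
        - (∫ t in Ioi (0 : ℝ), Real.exp (-((((side k L j : ℝ) ^ 2)⁻¹) * t)) * prodHeat (2 * t) p.1 z)
        = ∫ t in Ioi (0 : ℝ), Real.exp (-((((side k L j : ℝ) ^ 2)⁻¹) * t)) *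
            (prodHeat (2 * t) (p.1 + Pi.single ν 1) z - prodHeat (2 * t) p.1 z) := by
    intro z
    rw [← integral_sub (integrable_exp_mul_prodHeat d k N L j _ z) (integrable_exp_mul_prodHeat d k N L j _ z)]
    refine setIntegral_congr_fun measurableSet_Ioi fun t _ => ?_
    ring
  have hterm : ∀ q : TPt (d + 1) (N * L ^ k) × Fin (d + 1), |rowDiff d k N L ν (freeOp d k N L j) p q|
      = if p.2 = q.2 then |∫ t in Ioi (0 : ℝ), Real.exp (-((((side k L j : ℝ) ^ 2)⁻¹) * t)) *
          (prodHeat (2 * t) (p.1 + Pi.single ν 1) q.1 - prodHeat (2 * t) p.1 q.1)| else 0 := by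
    intro q
    simp only [rowDiff, freeOp_apply]
    split_ifs with h
    · rw [hsub]
    · simp
  rw [Finset.sum_filter, Finset.sum_filter, Fintype.sum_prod_type]
  refine Finset.sum_congr rfl fun z _ => ?_
  simp only [cubeI_apply, hterm]
  split_ifs with hz
  · rw [Finset.sum_ite_eq]; simp
  · simp

/-- `√2·√π ≤ 3`. [folklore] -/
theorem sqrt_two_mul_sqrt_pi_le : Real.sqrt 2 * Real.sqrt π ≤ 3 := by
  rw [← Real.sqrt_mul (by norm_num)]
  rw [Real.sqrt_le_left (by norm_num)]
  nlinarith [Real.pi_lt_d2]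

/-- `∫₀^∞ t^{−1/2} e^{−t/(2n²)} dt ≤ 3n` (`= √(2π)·n`). [folklore] -/
theorem integral_rpow_neg_half_exp_le {n : ℝ} (hn : 0 < n) :
    IntegrableOn (fun t : ℝ => t ^ (-(1 / 2 : ℝ)) * Real.exp (-((2 * n ^ 2)⁻¹ * t))) (Ioi 0) ∧
      ∫ t in Ioi (0 : ℝ), t ^ (-(1 / 2 : ℝ)) * Real.exp (-((2 * n ^ 2)⁻¹ * t)) ≤ 3 * n := by
  have hb : 0 < (2 * n ^ 2)⁻¹ := by positivity
  refine ⟨?_, ?_⟩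
  · have h := integrableOn_rpow_mul_exp_neg_mul_rpow (s := -(1 / 2 : ℝ)) (p := 1) (by norm_num) le_rfl hb
    refine h.congr_fun (fun t _ => ?_) measurableSet_Ioi
    simp only [Real.rpow_one, neg_mul]
  · have h := integral_rpow_mul_exp_neg_mul_Ioi (a := 1 / 2) (r := (2 * n ^ 2)⁻¹) (by norm_num) hb
    rw [show (1 / 2 : ℝ) - 1 = -(1 / 2 : ℝ) by norm_num] at h
    have e : (1 / (2 * n ^ 2)⁻¹ : ℝ) ^ (1 / 2 : ℝ) = Real.sqrt 2 * n := by
      rw [show (1 / (2 * n ^ 2)⁻¹ : ℝ) = 2 * n ^ 2 by rw [one_div, inv_inv], ← Real.sqrt_eq_rpow,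
        Real.sqrt_mul (by norm_num), Real.sqrt_sq hn.le]
    rw [h, e, Real.Gamma_one_half_eq]
    calc Real.sqrt 2 * n * Real.sqrt π = (Real.sqrt 2 * Real.sqrt π) * n := by ring
      _ ≤ 3 * n := mul_le_mul_of_nonneg_right sqrt_two_mul_sqrt_pi_le hn.le

/-- **THE BLOCK-LOCALISED BOUND FOR THE UNIT ROW DIFFERENCES OF THE FREE RESOLVENT** ([B9] (3.42) item 1 in kernel form
for the free comparison operator, level-free and volume-free constants): for every level `j`, direction `ν`, row `p` and
block `y₁`, `Σ_{q : cubeI j q = y₁} |rowDiff ν (freeOp j) p q| ≤ freeC d · n · e^{−freeα d · nbd_j(cubeI j p, y₁)}`, `n = L^{min(j,k)}`.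
Proof: part 9's `blockSum_rowDiff_prodHeat_le` at heat time `2t` with weight slope `freeα d/n`, integrated against `e^{−t/n²}`;
the weight's cost `e^{t/(64n²)}` is absorbed and `∫₀^∞ t^{−1/2}e^{−t/(2n²)} dt ≤ 3n`. [folklore] -/
theorem cubeSum_rowDiff_freeOp_le (j : ℕ) (ν : Fin (d + 1)) (p : TPt (d + 1) (N * L ^ k) × Fin (d + 1))
    (y₁ : TPt (d + 1) (levM k N L j)) :
    ∑ q ∈ Finset.univ.filter (fun q => cubeI (d + 1) k N L (Fin (d + 1)) j q = y₁), |rowDiff d k N L ν (freeOp d k N L j) p q|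
      ≤ freeC d * (side k L j : ℝ) *
        Real.exp (-(freeα d * nbd (d + 1) k N L j (cubeI (d + 1) k N L (Fin (d + 1)) j p) y₁)) := by
  classical
  obtain ⟨hα0, hα32⟩ := freeα_pos_le d
  have hn1 : (1 : ℝ) ≤ (side k L j : ℝ) := by exact_mod_cast one_le_side k L j
  have hn0 : (0 : ℝ) < (side k L j : ℝ) := by linarith
  set n : ℝ := (side k L j : ℝ) with hndef
  set m : ℝ := (n ^ 2)⁻¹ with hmdef
  have hm : 0 < m := by positivity
  set filt := Finset.univ.filter (fun z : TPt (d + 1) (N * L ^ k) => cube (d + 1) k N L j z = y₁) with hfilt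
  set Dn : ℝ := (nbd (d + 1) k N L j (cubeI (d + 1) k N L (Fin (d + 1)) j p) y₁ : ℝ) with hDn
  -- the integrands and the majorant
  set f : TPt (d + 1) (N * L ^ k) → ℝ → ℝ := fun z t =>
    Real.exp (-(m * t)) * (prodHeat (2 * t) (p.1 + Pi.single ν 1) z - prodHeat (2 * t) p.1 z) with hf
  set K : ℝ := 1260 * 48 ^ d * Real.exp (freeα d * (d + 1)) * Real.exp (1 / 128) * Real.exp (-(freeα d * Dn)) with hK
  have hK0 : 0 ≤ K := by rw [hK]; positivity
  set M : ℝ → ℝ := fun t => K * (t ^ (-(1 / 2 : ℝ)) * Real.exp (-((2 * n ^ 2)⁻¹ * t))) with hM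
  have hfi : ∀ z, IntegrableOn (f z) (Ioi 0) := fun z => by
    have h := (integrable_exp_mul_prodHeat d k N L j (p.1 + Pi.single ν 1) z).sub
      (integrable_exp_mul_prodHeat d k N L j p.1 z)
    refine h.congr_fun (fun t _ => ?_) measurableSet_Ioi
    simp only [hf, Pi.sub_apply]; ring
  obtain ⟨hMi0, hMle⟩ := integral_rpow_neg_half_exp_le hn0
  have hMi : IntegrableOn M (Ioi 0) := hMi0.const_mul K
  -- pointwise: `Σ_z |f z t| ≤ M t` on `t > 0`
  have hpt : ∀ t ∈ Ioi (0 : ℝ), ∑ z ∈ filt, |f z t| ≤ M t := by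
    intro t ht
    have ht0 : (0 : ℝ) < t := ht
    have h2t : (0 : ℝ) < 2 * t := by linarith
    have hblk := blockSum_rowDiff_prodHeat_le (d := d) (fine_eq_levM_mul_side k N L j) h2t hα0.le hα32 p.1 y₁ ν
    have habs : ∑ z ∈ filt, |f z t| = Real.exp (-(m * t)) *
        ∑ z ∈ filt, |prodHeat (2 * t) (p.1 + Pi.single ν 1) z - prodHeat (2 * t) p.1 z| := by
      rw [Finset.mul_sum]
      refine Finset.sum_congr rfl fun z _ => ?_
      simp only [hf, abs_mul, abs_of_pos (Real.exp_pos _)]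
    rw [habs]
    have hnbd : (npl1 (blockPt (levM k N L j) (side k L j) p.1 - y₁) : ℝ) = Dn := rfl
    -- the factors of part 9's bound
    obtain ⟨hT1, hT0, -, -, -⟩ := max_one_facts (2 * t)
    have hTle : max 1 (2 * t) ≤ 1 + 2 * t := max_le (by linarith) (by linarith)
    have hrpow : (max 1 (2 * t)) ^ (-(1 / 2 : ℝ)) ≤ t ^ (-(1 / 2 : ℝ)) :=
      Real.rpow_le_rpow_of_nonpos ht0 (le_trans (by linarith) (le_max_right _ _)) (by norm_num)
    have hexp : Real.exp (-(m * t)) * Real.exp (8 * (d + 1) * (freeα d / (side k L j : ℝ)) ^ 2 * max 1 (2 * t))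
        ≤ Real.exp (1 / 128) * Real.exp (-((2 * n ^ 2)⁻¹ * t)) := by
      rw [← Real.exp_add, ← Real.exp_add]
      refine Real.exp_le_exp.2 ?_
      have hα2 : 8 * ((d : ℝ) + 1) * (freeα d) ^ 2 ≤ 1 / 128 := by
        unfold freeα
        rw [div_pow, one_pow, show (32 * ((d : ℝ) + 1)) ^ 2 = 1024 * ((d : ℝ) + 1) * ((d : ℝ) + 1) by ring]
        rw [mul_one_div, div_le_iff₀ (by positivity)]
        nlinarith [(Nat.cast_nonneg d : (0 : ℝ) ≤ d)]
      have hn2 : (1 : ℝ) ≤ n ^ 2 := by nlinarith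
      have e1 : 8 * ((d : ℝ) + 1) * (freeα d / n) ^ 2 * max 1 (2 * t)
          = (8 * ((d : ℝ) + 1) * (freeα d) ^ 2) * (max 1 (2 * t) / n ^ 2) := by rw [div_pow]; ring
      rw [hmdef, ← hndef, e1]
      have h3 : (8 * ((d : ℝ) + 1) * (freeα d) ^ 2) * (max 1 (2 * t) / n ^ 2) ≤ 1 / 128 * ((1 + 2 * t) / n ^ 2) :=
        mul_le_mul hα2 (div_le_div_of_nonneg_right hTle (by positivity)) (by positivity) (by norm_num)
      have h4 : 1 / 128 * ((1 + 2 * t) / n ^ 2) ≤ 1 / 128 + t / (64 * n ^ 2) := by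
        rw [show 1 / 128 * ((1 + 2 * t) / n ^ 2) = (1 / 128) / n ^ 2 + t / (64 * n ^ 2) by field_simp; ring]
        have : (1 / 128 : ℝ) / n ^ 2 ≤ 1 / 128 := div_le_self (by norm_num) hn2
        linarith
      have h5 : -((n ^ 2)⁻¹ * t) + (1 / 128 + t / (64 * n ^ 2)) ≤ 1 / 128 + -((2 * n ^ 2)⁻¹ * t) := by
        rw [show -((n ^ 2)⁻¹ * t) + (1 / 128 + t / (64 * n ^ 2)) = 1 / 128 - (63 / 64) * (t / n ^ 2) by field_simp; ring,
          show 1 / 128 + -((2 * n ^ 2)⁻¹ * t) = 1 / 128 - (1 / 2) * (t / n ^ 2) by field_simp; ring]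
        have : 0 ≤ t / n ^ 2 := by positivity
        nlinarith
      linarith
    calc Real.exp (-(m * t)) * ∑ z ∈ filt, |prodHeat (2 * t) (p.1 + Pi.single ν 1) z - prodHeat (2 * t) p.1 z|
        ≤ Real.exp (-(m * t)) * (1260 * 48 ^ d * Real.exp (freeα d * (d + 1)) * (max 1 (2 * t)) ^ (-(1 / 2 : ℝ)) *
            Real.exp (8 * (d + 1) * (freeα d / (side k L j : ℝ)) ^ 2 * max 1 (2 * t)) * Real.exp (-(freeα d * Dn))) := by
          rw [← hnbd]; exact mul_le_mul_of_nonneg_left hblk (Real.exp_pos _).le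
      _ = 1260 * 48 ^ d * Real.exp (freeα d * (d + 1)) * Real.exp (-(freeα d * Dn)) *
            (max 1 (2 * t)) ^ (-(1 / 2 : ℝ)) *
            (Real.exp (-(m * t)) * Real.exp (8 * (d + 1) * (freeα d / (side k L j : ℝ)) ^ 2 * max 1 (2 * t))) := by ring
      _ ≤ 1260 * 48 ^ d * Real.exp (freeα d * (d + 1)) * Real.exp (-(freeα d * Dn)) *
            t ^ (-(1 / 2 : ℝ)) * (Real.exp (1 / 128) * Real.exp (-((2 * n ^ 2)⁻¹ * t))) := by
          gcongr
      _ = M t := by simp only [hM, hK]; ring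
  -- integrability of `Σ_z |f z|`
  have hsi : IntegrableOn (fun t => ∑ z ∈ filt, |f z t|) (Ioi 0) :=
    integrable_finsetSum _ fun z _ => (hfi z).abs
  -- assemble
  calc ∑ q ∈ Finset.univ.filter (fun q => cubeI (d + 1) k N L (Fin (d + 1)) j q = y₁), |rowDiff d k N L ν (freeOp d k N L j) p q|
      = ∑ z ∈ filt, |∫ t in Ioi (0 : ℝ), f z t| := by
        rw [cubeSum_rowDiff_freeOp_eq]
    _ ≤ ∑ z ∈ filt, ∫ t in Ioi (0 : ℝ), |f z t| := Finset.sum_le_sum fun z _ => abs_integral_le_integral_abs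
    _ = ∫ t in Ioi (0 : ℝ), ∑ z ∈ filt, |f z t| := (integral_finsetSum _ fun z _ => (hfi z).abs).symm
    _ ≤ ∫ t in Ioi (0 : ℝ), M t := setIntegral_mono_on hsi hMi measurableSet_Ioi hpt
    _ = K * ∫ t in Ioi (0 : ℝ), t ^ (-(1 / 2 : ℝ)) * Real.exp (-((2 * n ^ 2)⁻¹ * t)) := by
        simp only [hM]; exact integral_const_mul K _
    _ ≤ K * (3 * n) := mul_le_mul_of_nonneg_left hMle hK0
    _ ≤ freeC d * n * Real.exp (-(freeα d * Dn)) := by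
        rw [hK, freeC]
        have h1 : Real.exp (freeα d * (d + 1)) = Real.exp (1 / 32) := by
          congr 1; unfold freeα; field_simp
        have h2 : Real.exp (1 / 32) * Real.exp (1 / 128) * 3 ≤ 4 := by
          rw [← Real.exp_add]
          have := Real.exp_bound' (x := 1 / 32 + 1 / 128) (by norm_num) (by norm_num) (n := 1) (by norm_num)
          nlinarith [Real.add_one_le_exp (1 / 32 + 1 / 128 : ℝ), Real.exp_pos (1 / 32 + 1 / 128 : ℝ),
            show Real.exp (1 / 32 + 1 / 128 : ℝ) ≤ 4 / 3 from by
              have h := Real.exp_bound (x := 1 / 32 + 1 / 128) (by rw [abs_of_nonneg (by norm_num)]; norm_num) (n := 2) (by norm_num)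
              simp only [Finset.sum_range_succ, Finset.sum_range_zero, Nat.factorial] at h
              norm_num at h
              rw [abs_le] at h
              nlinarith [h.2]]
        rw [h1]
        have hE : 0 ≤ Real.exp (-(freeα d * Dn)) := (Real.exp_pos _).le
        have h48 : (0 : ℝ) ≤ 48 ^ d := by positivity
        nlinarith [mul_nonneg (mul_nonneg h48 hE) hn0.le, h2]

end Gradient

end Summit.QuantumFields.BalabanUV.T4Continuum.SliceFlatFreeResolvent
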